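import Summits.CriticalPhenomena.SAWScalingLimit.Theorems.MassRatio.Negative.StarB

/-!
# Crux `MassRatio` (stmt-CriticalPhenomena-8550) — load-bearing hypotheses, part 21: the dead line's stub 1 versus the phase-free modulus floor — `SignalCoherence(L1)`, `ModulusFloor(L1)` and, UNDER the sibling crux `DefectDecoherence` (as a hypothesis), their equivalence for `θ' ≤ 3/4` (`signalCoherence_of_modulusFloor`, `signalCoherenceL1_of_modulusFloorL1` and converses): the relative phases at a star are not the difficulty, the per-edge modulus `|F_{5/8}(e)|/Z(e)` is

Negative knowledge on the crux `MassRatio` (stmt-CriticalPhenomena-8550, route SAWDefectDecoherence r3),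
written by the standing disprover (cdisprove, cycles 1–4). The series `MassRatio/Negative/*` does NOT
refute the crux (verdict: RESISTS — it is a pure exponent bet, predicted ratio `δ^{-25/48}` against the
cut `δ^{-3/4}`); it proves which hypotheses of the crux are LOAD-BEARING (rows clause, `0 < ρ`,
`δ·mid(b_δ) → b`, exhaustion of compacts: each deleted ⇒ FALSE, by explicit admissible families in the
rectangle `D₀ = (-2,2)×(-1,1)` whose boundary mass at the target edge is starved EXACTLY by a bare
corridor), that the hypothesis frame is satisfiable (`massRatio_frame_nonvacuous`), and that the
`Nonempty`-SAW clause is implied by the others. Mechanism throughout: on a bare root-attached corridor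
the self-avoiding walk is unique, so `|Z| = x_c^{length}` exactly, while a staircase walk certifies
`|Z(e₀)| ≥ x_c^{2 iK + 1}` at a mid-edge `e₀` of the compact `Kbox`; `x_c < 3/5` and Bernoulli finish.
-/

namespace Summit.CriticalPhenomena.SAWScalingLimit.Theorems.MassRatio.Negative

open Literature.Probability.LatticeModels Literature.Probability.RandomPlanarGeometry.SAW
open Literature.Probability.RandomPlanarGeometry
open Summit.CriticalPhenomena.SAWScalingLimit.Theses.SAWDefectDecoherence

/-! ### J.4 Stub 1 (pointwise and `K`-summed) versus the phase-free modulus floor -/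

/-- `SignalCoherence θ'` — verbatim copy of the skeleton's pointwise floor predicate
(`Lines/coherence-floor-rh-harnack.lean`, round 1; kept there as a sufficient condition). [folklore] -/
def SignalCoherence (θ' : ℝ) : Prop :=
  ∀ (D : DobrushinDomain) (ρ : ℝ) (Λ : ℝ → Finset HexVertex) (m : ℝ → ℤ)
    (a b : ℝ → Sym2 HexVertex),
    0 < ρ →
    D.carrier ∩ Metric.ball (D.pt 1) ρ = {z : ℂ | (D.pt 1).im < z.im} ∩ Metric.ball (D.pt 1) ρ →
    (∀ᶠ δ : ℝ in nhdsWithin 0 (Set.Ioi 0),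
      hexDomainSimplyConnected (Λ δ) ∧ a δ ∈ hexDomainBoundary (Λ δ) ∧
        b δ ∈ hexDomainBoundary (Λ δ) ∧ Nonempty (HexMidEdgeSAW (Λ δ) (a δ) (b δ)) ∧
        (hexGraph.induce ((Λ δ : Finset HexVertex) : Set HexVertex)).Preconnected ∧
        (∀ v ∈ Λ δ, (δ : ℂ) * hexCenter v ∈ D.carrier) ∧
        (∀ v : HexVertex, (δ : ℂ) * hexCenter v ∈ Metric.ball (D.pt 1) ρ →
          (v ∈ Λ δ ↔ m δ ≤ v.1 1))) →
    (∀ K : Set ℂ, IsCompact K → K ⊆ D.carrier → ∀ᶠ δ : ℝ in nhdsWithin 0 (Set.Ioi 0),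
      ∀ v : HexVertex, (δ : ℂ) * hexCenter v ∈ K → v ∈ Λ δ) →
    Filter.Tendsto (fun δ : ℝ => (δ : ℂ) * hexMidpoint (a δ)) (nhdsWithin 0 (Set.Ioi 0))
      (nhds (D.pt 0)) →
    Filter.Tendsto (fun δ : ℝ => (δ : ℂ) * hexMidpoint (b δ)) (nhdsWithin 0 (Set.Ioi 0))
      (nhds (D.pt 1)) →
    ∀ K : Set ℂ, IsCompact K → K ⊆ D.carrier → ∃ c : ℝ, 0 < c ∧
      ∀ᶠ δ : ℝ in nhdsWithin 0 (Set.Ioi 0),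
        ∀ v : HexVertex, (δ : ℂ) * hexCenter v ∈ K →
        c * δ ^ θ' * (∑ t ∈ (Λ δ).filter (fun t => hexGraph.Adj v t),
            ‖hexParafermionicObservable (Λ δ) (a δ) hexCriticalFugacity 0 s(v, t)‖) ≤
          ‖∑ t ∈ (Λ δ).filter (fun t => hexGraph.Adj v t),
            hexParafermionicObservable (Λ δ) (a δ) hexCriticalFugacity (5 / 8) s(v, t)‖

/-- `SignalCoherenceL1 θ'` — verbatim copy of the skeleton's `K`-SUMMED floor predicate (reshape 1;
the registered stub `stub_signalCoherenceL1` is `∃ θ' < 3/4, SignalCoherenceL1 θ'`). [folklore] -/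
def SignalCoherenceL1 (θ' : ℝ) : Prop :=
  ∀ (D : DobrushinDomain) (ρ : ℝ) (Λ : ℝ → Finset HexVertex) (m : ℝ → ℤ)
    (a b : ℝ → Sym2 HexVertex),
    0 < ρ →
    D.carrier ∩ Metric.ball (D.pt 1) ρ = {z : ℂ | (D.pt 1).im < z.im} ∩ Metric.ball (D.pt 1) ρ →
    (∀ᶠ δ : ℝ in nhdsWithin 0 (Set.Ioi 0),
      hexDomainSimplyConnected (Λ δ) ∧ a δ ∈ hexDomainBoundary (Λ δ) ∧
        b δ ∈ hexDomainBoundary (Λ δ) ∧ Nonempty (HexMidEdgeSAW (Λ δ) (a δ) (b δ)) ∧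
        (hexGraph.induce ((Λ δ : Finset HexVertex) : Set HexVertex)).Preconnected ∧
        (∀ v ∈ Λ δ, (δ : ℂ) * hexCenter v ∈ D.carrier) ∧
        (∀ v : HexVertex, (δ : ℂ) * hexCenter v ∈ Metric.ball (D.pt 1) ρ →
          (v ∈ Λ δ ↔ m δ ≤ v.1 1))) →
    (∀ K : Set ℂ, IsCompact K → K ⊆ D.carrier → ∀ᶠ δ : ℝ in nhdsWithin 0 (Set.Ioi 0),
      ∀ v : HexVertex, (δ : ℂ) * hexCenter v ∈ K → v ∈ Λ δ) →
    Filter.Tendsto (fun δ : ℝ => (δ : ℂ) * hexMidpoint (a δ)) (nhdsWithin 0 (Set.Ioi 0))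
      (nhds (D.pt 0)) →
    Filter.Tendsto (fun δ : ℝ => (δ : ℂ) * hexMidpoint (b δ)) (nhdsWithin 0 (Set.Ioi 0))
      (nhds (D.pt 1)) →
    ∀ K : Set ℂ, IsCompact K → K ⊆ D.carrier → ∃ c : ℝ, 0 < c ∧
      ∀ᶠ δ : ℝ in nhdsWithin 0 (Set.Ioi 0),
        c * δ ^ θ' * (∑ᶠ v ∈ {v : HexVertex | v ∈ Λ δ ∧ (δ : ℂ) * hexCenter v ∈ K},
            ∑ t ∈ (Λ δ).filter (fun t => hexGraph.Adj v t),
              ‖hexParafermionicObservable (Λ δ) (a δ) hexCriticalFugacity 0 s(v, t)‖) ≤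
          ∑ᶠ v ∈ {v : HexVertex | v ∈ Λ δ ∧ (δ : ℂ) * hexCenter v ∈ K},
            ‖∑ t ∈ (Λ δ).filter (fun t => hexGraph.Adj v t),
              hexParafermionicObservable (Λ δ) (a δ) hexCriticalFugacity (5 / 8) s(v, t)‖

/-- `ModulusFloor θ'`: the PHASE-FREE floor — the same inequality with the modulus of the star
sum replaced by the star sum of moduli `Σ⋆ |F_{x_c,5/8}|` (pointwise form). [folklore] -/
def ModulusFloor (θ' : ℝ) : Prop :=
  ∀ (D : DobrushinDomain) (ρ : ℝ) (Λ : ℝ → Finset HexVertex) (m : ℝ → ℤ)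
    (a b : ℝ → Sym2 HexVertex),
    0 < ρ →
    D.carrier ∩ Metric.ball (D.pt 1) ρ = {z : ℂ | (D.pt 1).im < z.im} ∩ Metric.ball (D.pt 1) ρ →
    (∀ᶠ δ : ℝ in nhdsWithin 0 (Set.Ioi 0),
      hexDomainSimplyConnected (Λ δ) ∧ a δ ∈ hexDomainBoundary (Λ δ) ∧
        b δ ∈ hexDomainBoundary (Λ δ) ∧ Nonempty (HexMidEdgeSAW (Λ δ) (a δ) (b δ)) ∧
        (hexGraph.induce ((Λ δ : Finset HexVertex) : Set HexVertex)).Preconnected ∧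
        (∀ v ∈ Λ δ, (δ : ℂ) * hexCenter v ∈ D.carrier) ∧
        (∀ v : HexVertex, (δ : ℂ) * hexCenter v ∈ Metric.ball (D.pt 1) ρ →
          (v ∈ Λ δ ↔ m δ ≤ v.1 1))) →
    (∀ K : Set ℂ, IsCompact K → K ⊆ D.carrier → ∀ᶠ δ : ℝ in nhdsWithin 0 (Set.Ioi 0),
      ∀ v : HexVertex, (δ : ℂ) * hexCenter v ∈ K → v ∈ Λ δ) →
    Filter.Tendsto (fun δ : ℝ => (δ : ℂ) * hexMidpoint (a δ)) (nhdsWithin 0 (Set.Ioi 0))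
      (nhds (D.pt 0)) →
    Filter.Tendsto (fun δ : ℝ => (δ : ℂ) * hexMidpoint (b δ)) (nhdsWithin 0 (Set.Ioi 0))
      (nhds (D.pt 1)) →
    ∀ K : Set ℂ, IsCompact K → K ⊆ D.carrier → ∃ c : ℝ, 0 < c ∧
      ∀ᶠ δ : ℝ in nhdsWithin 0 (Set.Ioi 0),
        ∀ v : HexVertex, (δ : ℂ) * hexCenter v ∈ K →
        c * δ ^ θ' * (∑ t ∈ (Λ δ).filter (fun t => hexGraph.Adj v t),
            ‖hexParafermionicObservable (Λ δ) (a δ) hexCriticalFugacity 0 s(v, t)‖) ≤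
          ∑ t ∈ (Λ δ).filter (fun t => hexGraph.Adj v t),
            ‖hexParafermionicObservable (Λ δ) (a δ) hexCriticalFugacity (5 / 8) s(v, t)‖

/-- `ModulusFloorL1 θ'`: the phase-free floor, `K`-summed. [folklore] -/
def ModulusFloorL1 (θ' : ℝ) : Prop :=
  ∀ (D : DobrushinDomain) (ρ : ℝ) (Λ : ℝ → Finset HexVertex) (m : ℝ → ℤ)
    (a b : ℝ → Sym2 HexVertex),
    0 < ρ →
    D.carrier ∩ Metric.ball (D.pt 1) ρ = {z : ℂ | (D.pt 1).im < z.im} ∩ Metric.ball (D.pt 1) ρ →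
    (∀ᶠ δ : ℝ in nhdsWithin 0 (Set.Ioi 0),
      hexDomainSimplyConnected (Λ δ) ∧ a δ ∈ hexDomainBoundary (Λ δ) ∧
        b δ ∈ hexDomainBoundary (Λ δ) ∧ Nonempty (HexMidEdgeSAW (Λ δ) (a δ) (b δ)) ∧
        (hexGraph.induce ((Λ δ : Finset HexVertex) : Set HexVertex)).Preconnected ∧
        (∀ v ∈ Λ δ, (δ : ℂ) * hexCenter v ∈ D.carrier) ∧
        (∀ v : HexVertex, (δ : ℂ) * hexCenter v ∈ Metric.ball (D.pt 1) ρ →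
          (v ∈ Λ δ ↔ m δ ≤ v.1 1))) →
    (∀ K : Set ℂ, IsCompact K → K ⊆ D.carrier → ∀ᶠ δ : ℝ in nhdsWithin 0 (Set.Ioi 0),
      ∀ v : HexVertex, (δ : ℂ) * hexCenter v ∈ K → v ∈ Λ δ) →
    Filter.Tendsto (fun δ : ℝ => (δ : ℂ) * hexMidpoint (a δ)) (nhdsWithin 0 (Set.Ioi 0))
      (nhds (D.pt 0)) →
    Filter.Tendsto (fun δ : ℝ => (δ : ℂ) * hexMidpoint (b δ)) (nhdsWithin 0 (Set.Ioi 0))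
      (nhds (D.pt 1)) →
    ∀ K : Set ℂ, IsCompact K → K ⊆ D.carrier → ∃ c : ℝ, 0 < c ∧
      ∀ᶠ δ : ℝ in nhdsWithin 0 (Set.Ioi 0),
        c * δ ^ θ' * (∑ᶠ v ∈ {v : HexVertex | v ∈ Λ δ ∧ (δ : ℂ) * hexCenter v ∈ K},
            ∑ t ∈ (Λ δ).filter (fun t => hexGraph.Adj v t),
              ‖hexParafermionicObservable (Λ δ) (a δ) hexCriticalFugacity 0 s(v, t)‖) ≤
          ∑ᶠ v ∈ {v : HexVertex | v ∈ Λ δ ∧ (δ : ℂ) * hexCenter v ∈ K},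
            ∑ t ∈ (Λ δ).filter (fun t => hexGraph.Adj v t),
              ‖hexParafermionicObservable (Λ δ) (a δ) hexCriticalFugacity (5 / 8) s(v, t)‖

/-- The vertices of `Λ'` with centre in `K` form a finite set. [folklore] -/
theorem finite_center_set {Λ' : Finset HexVertex} {δ : ℝ} {K : Set ℂ} :
    {v : HexVertex | v ∈ Λ' ∧ (δ : ℂ) * hexCenter v ∈ K}.Finite :=
  Λ'.finite_toSet.subset fun _ hv => hv.1

/-- The `finsum` over `{v ∈ Λ' | δ·c_v ∈ K}` as a `Finset` sum. [folklore] -/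
theorem finsum_center_eq {Λ' : Finset HexVertex} {δ : ℝ} {K : Set ℂ} (f : HexVertex → ℝ) :
    ∑ᶠ v ∈ {v : HexVertex | v ∈ Λ' ∧ (δ : ℂ) * hexCenter v ∈ K}, f v =
      ∑ v ∈ (finite_center_set (Λ' := Λ') (δ := δ) (K := K)).toFinset, f v :=
  finsum_mem_eq_finite_toFinset_sum f _

/-- Floor ⟹ modulus floor (triangle inequality), pointwise. [folklore] -/
theorem modulusFloor_of_signalCoherence {θ' : ℝ} (h : SignalCoherence θ') : ModulusFloor θ' := by
  intro D ρ Λ m a b hρ hflat hadm hexh ha hb K hK hKD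
  obtain ⟨c, hc, hfl⟩ := h D ρ Λ m a b hρ hflat hadm hexh ha hb K hK hKD
  exact ⟨c, hc, hfl.mono fun δ hδ v hv => (hδ v hv).trans (norm_sum_le _ _)⟩

/-- Floor ⟹ modulus floor, `K`-summed. [folklore] -/
theorem modulusFloorL1_of_signalCoherenceL1 {θ' : ℝ} (h : SignalCoherenceL1 θ') :
    ModulusFloorL1 θ' := by
  intro D ρ Λ m a b hρ hflat hadm hexh ha hb K hK hKD
  obtain ⟨c, hc, hfl⟩ := h D ρ Λ m a b hρ hflat hadm hexh ha hb K hK hKD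
  refine ⟨c, hc, hfl.mono fun δ hδ => hδ.trans ?_⟩
  rw [finsum_center_eq, finsum_center_eq]
  exact Finset.sum_le_sum fun v _ => norm_sum_le _ _

/-- The eventual per-star package under `DefectDecoherence`: deep in `K`, every vertex is in `Λ_δ`
with its full star, and `Σ⋆|F| - B δ^{θ'} Σ⋆Z ≤ |S(v)|` with `B ≤ c/2` — for any prescribed `c > 0`
and any `θ' ≤ 3/4`. [folklore] -/
theorem eventually_star_package (hDD : DefectDecoherence) {θ' c : ℝ} (hθ' : θ' ≤ 3 / 4) (hc : 0 < c)
    {D : DobrushinDomain} {ρ : ℝ} {Λ : ℝ → Finset HexVertex} {m : ℝ → ℤ}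
    {a b : ℝ → Sym2 HexVertex}
    (hadm : ∀ᶠ δ : ℝ in nhdsWithin 0 (Set.Ioi 0),
      hexDomainSimplyConnected (Λ δ) ∧ a δ ∈ hexDomainBoundary (Λ δ) ∧
        b δ ∈ hexDomainBoundary (Λ δ) ∧ Nonempty (HexMidEdgeSAW (Λ δ) (a δ) (b δ)) ∧
        (hexGraph.induce ((Λ δ : Finset HexVertex) : Set HexVertex)).Preconnected ∧
        (∀ v ∈ Λ δ, (δ : ℂ) * hexCenter v ∈ D.carrier) ∧
        (∀ v : HexVertex, (δ : ℂ) * hexCenter v ∈ Metric.ball (D.pt 1) ρ →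
          (v ∈ Λ δ ↔ m δ ≤ v.1 1)))
    (hexh : ∀ K : Set ℂ, IsCompact K → K ⊆ D.carrier → ∀ᶠ δ : ℝ in nhdsWithin 0 (Set.Ioi 0),
      ∀ v : HexVertex, (δ : ℂ) * hexCenter v ∈ K → v ∈ Λ δ)
    {K : Set ℂ} (hK : IsCompact K) (hKD : K ⊆ D.carrier) :
    ∃ B : ℝ, ∀ᶠ δ : ℝ in nhdsWithin 0 (Set.Ioi 0), 0 < δ ∧ B ≤ c / 2 ∧
      ∀ v : HexVertex, (δ : ℂ) * hexCenter v ∈ K → v ∈ Λ δ ∧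
        (∑ t ∈ (Λ δ).filter (fun t => hexGraph.Adj v t),
            ‖hexParafermionicObservable (Λ δ) (a δ) hexCriticalFugacity (5 / 8) s(v, t)‖) -
          B * δ ^ θ' * (∑ t ∈ (Λ δ).filter (fun t => hexGraph.Adj v t),
            ‖hexParafermionicObservable (Λ δ) (a δ) hexCriticalFugacity 0 s(v, t)‖) ≤
        ‖∑ t ∈ (Λ δ).filter (fun t => hexGraph.Adj v t),
            hexParafermionicObservable (Λ δ) (a δ) hexCriticalFugacity (5 / 8) s(v, t)‖ := by
  obtain ⟨C, θ, hθ, hdd⟩ := hDD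
  obtain ⟨d, hd, hdD⟩ := hK.exists_cthickening_subset_open D.isOpen hKD
  have hex₁ := hexh (Metric.cthickening d K) hK.cthickening hdD
  set A : ℝ := 2 * Real.sqrt 3 * max C 0 * d ^ (-θ) with hA
  have hA0 : 0 ≤ A := by positivity
  have hε : 0 < c / (2 * (A + 1)) := by positivity
  have hpow : ∀ᶠ δ : ℝ in nhdsWithin 0 (Set.Ioi 0), δ ^ (θ - θ') < c / (2 * (A + 1)) := by
    have hcont : Filter.Tendsto (fun δ : ℝ => δ ^ (θ - θ')) (nhdsWithin 0 (Set.Ioi 0)) (nhds 0) := by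
      have h := (Real.continuousAt_rpow_const 0 (θ - θ') (Or.inr (by linarith))).tendsto
      rw [Real.zero_rpow (by linarith)] at h
      exact tendsto_nhdsWithin_of_tendsto_nhds h
    exact hcont (Iio_mem_nhds hε)
  have hsmall : ∀ᶠ δ : ℝ in nhdsWithin 0 (Set.Ioi 0), δ ∈ Set.Ioo 0 (min 1 d) :=
    Ioo_mem_nhdsGT (lt_min one_pos hd)
  -- `B = A δ^{θ-θ'}` depends on `δ`; we bound it by the constant `c/2` and use `B := c/2`
  refine ⟨c / 2, ?_⟩
  filter_upwards [hadm, hex₁, hsmall, hpow] with δ hadmδ hex hδ hpowδ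
  obtain ⟨hδ0, hδ1⟩ := hδ
  have hδd : δ ≤ d := ((lt_min_iff.1 hδ1).2).le
  refine ⟨hδ0, le_rfl, fun v hvK => ?_⟩
  obtain ⟨hsc, haδ, -, -, -, -, -⟩ := hadmδ
  obtain ⟨hedge, u, w, hauw, hwΛ, huΛ⟩ := haδ
  have huw : hexGraph.Adj u w := by
    rw [hauw] at hedge; exact (SimpleGraph.mem_edgeSet _).1 hedge
  have hR : 1 ≤ d / δ := by rw [le_div_iff₀ hδ0]; linarith
  have hdeep : ∀ y : HexVertex, dist (hexCenter y) (hexCenter v) ≤ d / δ → y ∈ Λ δ := by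
    intro y hy
    refine hex y (Metric.mem_cthickening_of_dist_le _ _ _ _ hvK ?_)
    rw [dist_eq_norm] at hy ⊢
    rw [← mul_sub, norm_mul, Complex.norm_real, Real.norm_of_nonneg hδ0.le]
    calc δ * ‖hexCenter y - hexCenter v‖ ≤ δ * (d / δ) := by gcongr
      _ = d := mul_div_cancel₀ _ hδ0.ne'
  have hvΛ : v ∈ Λ δ := hdeep v (by rw [dist_self]; positivity)
  have hnb : ∀ t, hexGraph.Adj v t → t ∈ Λ δ := fun t ht => hdeep t ((dist_center_le_one ht).trans hR)
  have hT := hdd (Λ δ) hsc u w huw huΛ hwΛ v (d / δ) hR hdeep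
  rw [← hauw] at hT
  have hstar := (star_bounds hsc ⟨hedge, u, w, hauw, hwΛ, huΛ⟩ hvΛ hnb).1
  refine ⟨hvΛ, ?_⟩
  -- names for the four star quantities
  set Zs := ∑ t ∈ (Λ δ).filter (fun t => hexGraph.Adj v t),
    ‖hexParafermionicObservable (Λ δ) (a δ) hexCriticalFugacity 0 s(v, t)‖ with hZs
  set Fs := ∑ t ∈ (Λ δ).filter (fun t => hexGraph.Adj v t),
    ‖hexParafermionicObservable (Λ δ) (a δ) hexCriticalFugacity (5 / 8) s(v, t)‖ with hFs
  set Tn := ‖∑ t ∈ (Λ δ).filter (fun t => hexGraph.Adj v t),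
    (starRingEnd ℂ) (hexMidpoint s(v, t) - hexCenter v) *
      hexParafermionicObservable (Λ δ) (a δ) hexCriticalFugacity (5 / 8) s(v, t)‖ with hTn
  have hZs0 : 0 ≤ Zs := Finset.sum_nonneg (fun _ _ => norm_nonneg _)
  have halg : (d / δ) ^ (-θ) = d ^ (-θ) * δ ^ θ := by
    rw [Real.div_rpow hd.le hδ0.le, Real.rpow_neg hδ0.le, div_inv_eq_mul]
  have hsplit : δ ^ θ = δ ^ (θ - θ') * δ ^ θ' := by
    rw [← Real.rpow_add hδ0]; ring_nf
  set P := δ ^ θ' * Zs with hP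
  have hP0 : 0 ≤ P := by positivity
  -- `2√3 |T| ≤ A δ^{θ-θ'} P`
  have hT1 : Tn ≤ max C 0 * (d / δ) ^ (-θ) * Zs :=
    hT.trans (by gcongr; exact le_max_left _ _)
  have hT2 : 2 * Real.sqrt 3 * Tn ≤ (A * δ ^ (θ - θ')) * P := by
    have := mul_le_mul_of_nonneg_left hT1 (show (0:ℝ) ≤ 2 * Real.sqrt 3 by positivity)
    calc 2 * Real.sqrt 3 * Tn ≤ 2 * Real.sqrt 3 * (max C 0 * (d / δ) ^ (-θ) * Zs) := this
      _ = (A * δ ^ (θ - θ')) * P := by rw [halg, hsplit, hA, hP]; ring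
  -- `A δ^{θ-θ'} ≤ c/2`
  have hsm : A * δ ^ (θ - θ') ≤ c / 2 := by
    have h1 : A * δ ^ (θ - θ') ≤ A * (c / (2 * (A + 1))) :=
      mul_le_mul_of_nonneg_left hpowδ.le hA0
    have h2 : A * (c / (2 * (A + 1))) = c / 2 * (A / (A + 1)) := by field_simp
    have h3 : A / (A + 1) ≤ 1 := div_le_one_of_le₀ (by linarith) (by positivity)
    calc A * δ ^ (θ - θ') ≤ c / 2 * (A / (A + 1)) := h1.trans h2.le
      _ ≤ c / 2 * 1 := mul_le_mul_of_nonneg_left h3 (by positivity)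
      _ = c / 2 := mul_one _
  have hT3 : (A * δ ^ (θ - θ')) * P ≤ c / 2 * P := mul_le_mul_of_nonneg_right hsm hP0
  have e : c / 2 * δ ^ θ' * Zs = c / 2 * P := by rw [hP]; ring
  rw [e]
  linarith

/-- **Under `DefectDecoherence`, stub 1 is equivalent to the phase-free modulus floor (pointwise
form).** The vertex relation aligns the three edge values up to the conjugate defect
(`3F_t = S + ω^t T'`), and crux #2 says the defect is `o(δ^{3/4}) Σ⋆Z`; so at every `θ' ≤ 3/4` the
floor `c δ^{θ'} Σ⋆Z ≤ |S|` holds iff `c' δ^{θ'} Σ⋆Z ≤ Σ⋆|F|` does. What remains of stub 1 is thus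
a bound on the modulus `|F_{x_c,5/8}(e)|` of the winding characteristic function of walks to ONE
mid-edge — the relative phases of the three edges are not the issue. [folklore] -/
theorem signalCoherence_of_modulusFloor (hDD : DefectDecoherence) {θ' : ℝ} (hθ' : θ' ≤ 3 / 4)
    (hMF : ModulusFloor θ') : SignalCoherence θ' := by
  intro D ρ Λ m a b hρ hflat hadm hexh ha hb K hK hKD
  obtain ⟨c, hc, hmf⟩ := hMF D ρ Λ m a b hρ hflat hadm hexh ha hb K hK hKD
  obtain ⟨B, hpk⟩ := eventually_star_package hDD hθ' hc hadm hexh hK hKD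
  refine ⟨c / 2, by positivity, ?_⟩
  filter_upwards [hmf, hpk] with δ hmfδ hpkδ
  obtain ⟨hδ0, hB, hv⟩ := hpkδ
  intro v hvK
  obtain ⟨-, hst⟩ := hv v hvK
  have hm := hmfδ v hvK
  have hZ0 : 0 ≤ δ ^ θ' * ∑ t ∈ (Λ δ).filter (fun t => hexGraph.Adj v t),
      ‖hexParafermionicObservable (Λ δ) (a δ) hexCriticalFugacity 0 s(v, t)‖ :=
    mul_nonneg (Real.rpow_nonneg hδ0.le _) (Finset.sum_nonneg (fun _ _ => norm_nonneg _))
  nlinarith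

/-- **Under `DefectDecoherence`, the registered stub `stub_signalCoherenceL1` is equivalent to the
`K`-summed modulus floor** (`ModulusFloorL1 θ' → SignalCoherenceL1 θ'` for `θ' ≤ 3/4`; the
converse is `modulusFloorL1_of_signalCoherenceL1`). [folklore] -/
theorem signalCoherenceL1_of_modulusFloorL1 (hDD : DefectDecoherence) {θ' : ℝ} (hθ' : θ' ≤ 3 / 4)
    (hMF : ModulusFloorL1 θ') : SignalCoherenceL1 θ' := by
  intro D ρ Λ m a b hρ hflat hadm hexh ha hb K hK hKD
  obtain ⟨c, hc, hmf⟩ := hMF D ρ Λ m a b hρ hflat hadm hexh ha hb K hK hKD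
  obtain ⟨B, hpk⟩ := eventually_star_package hDD hθ' hc hadm hexh hK hKD
  refine ⟨c / 2, by positivity, (hmf.and hpk).mono fun δ hδ => ?_⟩
  obtain ⟨hmfδ, hδ0, hB, hv⟩ := hδ
  have hS := finite_center_set (Λ' := Λ δ) (δ := δ) (K := K)
  rw [finsum_center_eq, finsum_center_eq] at hmfδ ⊢
  rw [Finset.mul_sum] at hmfδ ⊢
  -- sum the per-star package over the `K`-stars
  have key : ∀ v ∈ hS.toFinset,
      c / 2 * δ ^ θ' * (∑ t ∈ (Λ δ).filter (fun t => hexGraph.Adj v t),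
          ‖hexParafermionicObservable (Λ δ) (a δ) hexCriticalFugacity 0 s(v, t)‖) ≤
        ‖∑ t ∈ (Λ δ).filter (fun t => hexGraph.Adj v t),
            hexParafermionicObservable (Λ δ) (a δ) hexCriticalFugacity (5 / 8) s(v, t)‖ -
        ((∑ t ∈ (Λ δ).filter (fun t => hexGraph.Adj v t),
            ‖hexParafermionicObservable (Λ δ) (a δ) hexCriticalFugacity (5 / 8) s(v, t)‖) -
          c * δ ^ θ' * (∑ t ∈ (Λ δ).filter (fun t => hexGraph.Adj v t),
            ‖hexParafermionicObservable (Λ δ) (a δ) hexCriticalFugacity 0 s(v, t)‖)) := by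
    intro v hvS
    obtain ⟨-, hst⟩ := hv v (hS.mem_toFinset.1 hvS).2
    have hZ0 : 0 ≤ δ ^ θ' * ∑ t ∈ (Λ δ).filter (fun t => hexGraph.Adj v t),
        ‖hexParafermionicObservable (Λ δ) (a δ) hexCriticalFugacity 0 s(v, t)‖ :=
      mul_nonneg (Real.rpow_nonneg hδ0.le _) (Finset.sum_nonneg (fun _ _ => norm_nonneg _))
    nlinarith
  have hsum := Finset.sum_le_sum key
  rw [Finset.sum_sub_distrib, Finset.sum_sub_distrib] at hsum
  linarith

end Summit.CriticalPhenomena.SAWScalingLimit.Theorems.MassRatio.Negative
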